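import Summits.BirchSwinnertonDyer.BirchSwinnertonDyer.Theses.CongruentShaFreeCut
import Literature.NumberTheory.EllipticCurves.HeegnerFieldDescentProofs

/-! # Route `CongruentShaFreeCut` (rung S2) — crux `AnalyticRankOneOfRankOneFiniteShaTwo`
(stmt-BirchSwinnertonDyer-19080), line `heegner-field-gz`: the registered stub
`stub_heegnerFieldData` from refereed named facts

The BC3 skeleton of the crux (plan g8, sha16 d981ef2b) composes
`stub_heegnerFieldData → stub_twoConverseOverK → AnalyticRankOneOfRankOneFiniteShaTwo`. Its first
stub — for `n ≠ 0` with `rank E_n(ℚ) = 1` and `Ш(E_n/ℚ)[2^∞]` finite there is an imaginary quadratic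
`K` with the Heegner hypothesis for the full conductor of `E_n : y² = x³ − n²x` and `2` split in
`K`, over which `E_n` has Selmer corank one and rank one and whose twist contributes nothing to the
analytic rank — is fact-free as registered, but every printed input is a REFEREED named fact of the
tree: Greenberg's corank identity (a tree THEOREM), the `2`-parity theorem (`p_parity`), the
Modularity Theorem (`ModularForms.exists_isNewformOf`), Hoffstein–Luo 1997
(`HoffsteinLuo1997_exists_twist_L_one_ne_zero`) and Kato 2004 Cor. 14.3
(`kato_finite_of_L_one_ne_zero`). This file lands the BINDER-CARRYING form
`facts → <stub statement verbatim>` (the day-1 currency of GAP-LEDGER-read2-skeletons-g25, sk-3),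
by specialising the tree theorem
`exists_heegnerField_descent_of_mordellWeilRank_eq_one_of_finite_sha`
(`Literature/…/HeegnerFieldDescentProofs.lean`) to `W = congruentNumberCurve n`, `p = 2`.
It supports, and does not close, the item: the load-bearing stub `stub_twoConverseOverK`
(Rubin/BDP-type formula + explicit reciprocity law at `p = 2` for the additive curve `E_n`;
Fan–Wan v2 Thm. 4.2/4.4 + 6.9, unrefereed) is untouched. -/

namespace Summit.BirchSwinnertonDyer.BirchSwinnertonDyer.Theorems.CongruentShaFreeCutHeegnerFieldData

open Literature.NumberTheory.EllipticCurves WeierstrassCurve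

/-- **`stub_heegnerFieldData` of crux `AnalyticRankOneOfRankOneFiniteShaTwo` from refereed facts**
(statement after the binders = the registered stub, token for token): for `n ≠ 0` with
`rank E_n(ℚ) = 1` and `Ш(E_n/ℚ)[2^∞]` finite there is an imaginary quadratic field `K` satisfying
the Heegner hypothesis for `N(E_n)` and for `2`, with `corank_{ℤ₂} Sel_{2^∞}(E_n/K) = 1`,
`rank E_n(K) = 1` and `ord_{s=1} L(E_n/K, s) = ord_{s=1} L(E_n, s)` — granted `2`-parity (`hpar`),
modularity (`hmod`), Hoffstein–Luo (`hHL`) and Kato (`hKato`). -/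
theorem heegnerFieldData_of_parity_of_hoffsteinLuo_of_kato
    (hpar : ∀ (W : WeierstrassCurve ℚ) [W.IsElliptic] (p : ℕ) [Fact p.Prime], p_parity W p)
    (hmod : ModularForms.exists_isNewformOf) (hHL : HoffsteinLuo1997_exists_twist_L_one_ne_zero)
    (hKato : ∀ (W : WeierstrassCurve ℚ) [W.IsElliptic] (p : ℕ) [Fact p.Prime],
      kato_finite_of_L_one_ne_zero W p) :
    ∀ ⦃n : ℕ⦄, n ≠ 0 → (congruentNumberCurve n).mordellWeilRank = 1 →
      Finite (AddCommGroup.primaryComponent (congruentNumberCurve n).sha 2) →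
        ∃ (K : Type) (_ : Field K) (_ : NumberField K),
          IsImaginaryQuadratic K ∧
            SatisfiesHeegnerHypothesis ((congruentNumberCurve n).conductorNorm ℤ) K ∧
              SatisfiesHeegnerHypothesis 2 K ∧
                ((congruentNumberCurve n).baseChange K).selmerCorank 2 = 1 ∧
                  ((congruentNumberCurve n).baseChange K).mordellWeilRank = 1 ∧
                    analyticRankEK (congruentNumberCurve n) K =
                      (congruentNumberCurve n).analyticRank := by
  intro n hn hrank hsha
  haveI := isElliptic_congruentNumberCurve hn
  obtain ⟨K, _, _, hK, -, hHN, hH2, -, -, hcK, hrK, han⟩ :=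
    exists_heegnerField_descent_of_mordellWeilRank_eq_one_of_finite_sha hpar hmod hHL hKato
      (congruentNumberCurve n) 2 hrank hsha 0
  exact ⟨K, inferInstance, inferInstance, hK, hHN, hH2, hcK, hrK, han⟩

/-- **The same field with the extra data `|d_K| > B`, `d_K ≡ 1 (mod 8)` and
`L(E_n^{(d_K)}, 1) ≠ 0`** — what a `K`-level argument for `stub_twoConverseOverK` may consume
beyond the registered conjuncts, from the same four refereed facts. -/
theorem heegnerFieldData_full_of_parity_of_hoffsteinLuo_of_kato
    (hpar : ∀ (W : WeierstrassCurve ℚ) [W.IsElliptic] (p : ℕ) [Fact p.Prime], p_parity W p)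
    (hmod : ModularForms.exists_isNewformOf) (hHL : HoffsteinLuo1997_exists_twist_L_one_ne_zero)
    (hKato : ∀ (W : WeierstrassCurve ℚ) [W.IsElliptic] (p : ℕ) [Fact p.Prime],
      kato_finite_of_L_one_ne_zero W p)
    {n : ℕ} (hn : n ≠ 0) (hrank : (congruentNumberCurve n).mordellWeilRank = 1)
    (hsha : Finite (AddCommGroup.primaryComponent (congruentNumberCurve n).sha 2)) (B : ℕ) :
    ∃ (K : Type) (_ : Field K) (_ : NumberField K),
      IsImaginaryQuadratic K ∧ B < (NumberField.discr K).natAbs ∧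
        SatisfiesHeegnerHypothesis ((congruentNumberCurve n).conductorNorm ℤ) K ∧
          SatisfiesHeegnerHypothesis 2 K ∧ NumberField.discr K % 8 = 1 ∧
            ((congruentNumberCurve n).quadraticTwist (NumberField.discr K : ℚ)).entireLFunction 1
                ≠ 0 ∧
              ((congruentNumberCurve n).baseChange K).selmerCorank 2 = 1 ∧
                ((congruentNumberCurve n).baseChange K).mordellWeilRank = 1 ∧
                  analyticRankEK (congruentNumberCurve n) K =
                    (congruentNumberCurve n).analyticRank := by
  haveI := isElliptic_congruentNumberCurve hn
  exact exists_heegnerField_descent_of_mordellWeilRank_eq_one_of_finite_sha hpar hmod hHL hKato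
    (congruentNumberCurve n) 2 hrank hsha B

end Summit.BirchSwinnertonDyer.BirchSwinnertonDyer.Theorems.CongruentShaFreeCutHeegnerFieldData
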